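import Mathlib
import Literature.MathematicalPhysics.QuantumLattice.HubbardWave0
import HarnessLib

-- provenance: harness21/H21/H21/Prelude/QLatticeAQFT/FermionOperators.lean @ c661e31 (interim HEAD d8f2665); M5 mechanical rewrite
/-!
# Fermionic Fock-space operators (trunk T-QLATTICE, family `hubbard`)

Fermionic Fock-space API on top of the accepted wave-0 glue `Literature.Statements.Hubbard.Wave0`
(`Fock ι = Finset ι → ℂ`, Jordan–Wigner `annihilation`/`creation`, `IsNParticle`, `expect`,
Hubbard `numberOp`, `totalNumber`, `spinZ`, `spinPlus`, `spinSq`, …, all REUSED, never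
redefined). New declarations live in `Literature.QLattice`.

## Contents

* `numberAt i = c†ᵢ cᵢ`, `totalNumberOp = Σᵢ nᵢ`, `parityOp = (-1)^N` (as the diagonal matrix
  `|s⟩ ↦ (-1)^{#s} |s⟩`, equal to `∏ᵢ (1 - 2nᵢ)`), `hopping i j = c†ᵢ cⱼ + c†ⱼ cᵢ`;
* the `N`-particle sector `nParticleSubmodule N : Submodule ℂ (Fock ι)`;
* bridges to Mathlib: `Fock.toEuclidean : Fock ι ≃ₗ[ℂ] EuclideanSpace ℂ (Finset ι)`
  (`WithLp.linearEquiv`) with `expect_eq_inner`; `fockExteriorEquiv : Fock ι ≃ₗ[ℂ]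
  ExteriorAlgebra ℂ (ι → ℂ)` via Mathlib's `Module.Basis.ExteriorAlgebra` (basis of the exterior
  algebra indexed by `Finset ι`) applied to `Pi.basisFun`, and the bridge `creation_eq_wedge`
  (`c†ᵢ` is left exterior multiplication by `eᵢ`);
* the particle–hole transformation `particleHole ε` (`cᵢ ↦ εᵢ c†ᵢ`);
* Hubbard (`ι = Orb Λ = Λ ×ₗ Fin 2`) spin vector `spinVecF` and Yang's `η`-pairing operators
  `etaRaise`, `etaLower`, `etaZ`.

## Mathlib search

Mathlib has `ExteriorAlgebra`, `Module.Basis.ExteriorAlgebra`, `EuclideanSpace`,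
`Matrix.unitaryGroup`, `CliffordAlgebra`, but no fermionic Fock space / CAR algebra / second
quantisation (`rg` for `Fock`, `annihilation`, `creation`, `Jordan-Wigner`, `CAR` found nothing
relevant); hence the concrete matrix model of Wave0 is kept.

## Sources

Bratteli–Robinson, *Operator Algebras and Quantum Statistical Mechanics II* §5.2.2;
C. N. Yang, *η pairing and off-diagonal long-range order in a Hubbard model*, PRL 63 (1989) 2144;
H. Tasaki, *Physics and Mathematics of Quantum Many-Body Systems* (2020) §9.
-/

namespace Literature.MathematicalPhysics.QuantumLattice

open Matrix Finset HubbardWave0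
open scoped ComplexOrder InnerProductSpace

/-! ### Number, parity and hopping operators -/

section Fock

variable {ι : Type*} [LinearOrder ι]

/-- `c_i` is the conjugate transpose of `c†_i` (by definition of `creation`).
Bratteli–Robinson II §5.2.2. [folklore] -/
theorem annihilation_conjTranspose (i : ι) : (annihilation i)ᴴ = creation i := rfl

/-- `(c†_i)ᴴ = c_i`. Bratteli–Robinson II §5.2.2. [folklore] -/
@[simp] theorem creation_conjTranspose (i : ι) : (creation i)ᴴ = annihilation i :=
  conjTranspose_conjTranspose _

variable [Fintype ι]

/-- The occupation-number operator `n_i = c†_i c_i` of the orbital `i`.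
Bratteli–Robinson II §5.2.2; Tasaki (2020) §9.2. [cite: Tasaki2020] -/
def numberAt (i : ι) : Matrix (Finset ι) (Finset ι) ℂ := creation i * annihilation i

/-- The total particle-number operator `N = Σ_i n_i`. Tasaki (2020) §9.2. [cite: Tasaki2020] -/
def totalNumberOp : Matrix (Finset ι) (Finset ι) ℂ := ∑ i : ι, numberAt i

/-- The fermion parity operator `(-1)^N`, defined as the diagonal matrix `|s⟩ ↦ (-1)^{#s} |s⟩`;
it equals `∏_i (1 - 2 n_i)` (`parityOp_eq_noncommProd`). Tasaki (2020) §9.2. [cite: Tasaki2020] -/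
def parityOp : Matrix (Finset ι) (Finset ι) ℂ := diagonal fun s => (-1) ^ s.card

/-- The (Hermitian) hopping operator `c†_i c_j + c†_j c_i` between orbitals `i` and `j`
(for `i = j` this is `2 n_i`). Tasaki (2020) §9.3. [cite: Tasaki2020] -/
def hopping (i j : ι) : Matrix (Finset ι) (Finset ι) ℂ :=
  creation i * annihilation j + creation j * annihilation i

/-- Mixed CAR with the creation operator first (the orientation produced by normal ordering):
`c†_j c_i + c_i c†_j = δ_{ij}`. Restates Wave0's
`annihilation_mul_creation_add_creation_mul_annihilation` (a named fact there, hypothesis `hCAR`).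
Bratteli–Robinson II §5.2.2, (5.2.11)–(5.2.12). [folklore] -/
theorem creation_mul_annihilation_add
    (hCAR : annihilation_mul_creation_add_creation_mul_annihilation (ι := ι)) (i j : ι) :
    creation j * annihilation i + annihilation i * creation j =
      if i = j then (1 : Matrix (Finset ι) (Finset ι) ℂ) else 0 := by
  rw [add_comm]
  exact hCAR i j

/-- Pure CAR for creation operators: `c†_i c†_j + c†_j c†_i = 0`.
Bratteli–Robinson II §5.2.2, (5.2.11). [cite: BratteliRobinsonII1997, §5.2.2 (5.2.11)] -/
def creation_anticommute : Prop :=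
  ∀ (i j : ι),
    creation i * creation j + creation j * creation i = 0

/-- `n_i` is diagonal in the occupation basis: `n_i |s⟩ = [i ∈ s] |s⟩` (the only intermediate
state contributing to `⟨s| c†_i c_i |t⟩` is `s ∖ {i}`, with `i ∈ s = t`, and the two Jordan–Wigner
signs cancel). Tasaki (2020) §9.2. [cite: Tasaki2020] -/
theorem numberAt_eq_diagonal (i : ι) :
    numberAt i = diagonal fun s => if i ∈ s then 1 else 0 := by
  ext s t
  simp only [numberAt, creation, Matrix.mul_apply, conjTranspose_apply, annihilation,
    diagonal_apply]
  rw [Finset.sum_eq_single (s.erase i)]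
  · by_cases hi : i ∈ s
    · have h1 : i ∉ s.erase i ∧ s = insert i (s.erase i) :=
        ⟨Finset.notMem_erase i s, (Finset.insert_erase hi).symm⟩
      by_cases hst : s = t
      · subst hst
        simp only [if_pos h1, if_pos hi, if_true, jwSign, star_pow, star_neg, star_one,
          ← mul_pow, neg_mul_neg, mul_one, one_pow]
      · have h2 : ¬ (i ∉ s.erase i ∧ t = insert i (s.erase i)) :=
          fun h ↦ hst (h1.2.trans h.2.symm)
        rw [if_neg h2, mul_zero, if_neg hst]
    · have h2 : ¬ (i ∉ s.erase i ∧ s = insert i (s.erase i)) :=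
        fun h ↦ hi (h.2 ▸ Finset.mem_insert_self i _)
      rw [if_neg h2, star_zero, zero_mul]
      simp [hi]
  · intro u _ hu
    have h2 : ¬ (i ∉ u ∧ s = insert i u) := fun h ↦ hu (by rw [h.2, Finset.erase_insert h.1])
    simp [h2]
  · exact fun h ↦ absurd (Finset.mem_univ _) h

/-- `n_i² = n_i`. Bratteli–Robinson II §5.2.2. [cite: BratteliRobinsonII1997, §5.2.2] -/
theorem numberAt_idempotent (i : ι) : IsIdempotentElem (numberAt i) := by
  rw [IsIdempotentElem, numberAt_eq_diagonal, diagonal_mul_diagonal]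
  congr 1
  funext s
  split_ifs <;> simp

/-- Number operators commute: `n_i n_j = n_j n_i`. Bratteli–Robinson II §5.2.2. [cite: BratteliRobinsonII1997, §5.2.2] -/
theorem numberAt_commute (i j : ι) : Commute (numberAt i) (numberAt j) := by
  rw [Commute, SemiconjBy, numberAt_eq_diagonal, numberAt_eq_diagonal, diagonal_mul_diagonal,
    diagonal_mul_diagonal]
  congr 1
  funext s
  rw [mul_comm]

/-- `n_i` is Hermitian. Bratteli–Robinson II §5.2.2. [cite: BratteliRobinsonII1997, §5.2.2] -/
theorem numberAt_isHermitian (i : ι) : (numberAt i).IsHermitian := by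
  rw [Matrix.IsHermitian, numberAt, conjTranspose_mul, creation_conjTranspose,
    annihilation_conjTranspose]

/-- `N` is diagonal with eigenvalue `#s` on `|s⟩`. Tasaki (2020) §9.2. [cite: Tasaki2020] -/
theorem totalNumberOp_eq_diagonal :
    (totalNumberOp : Matrix (Finset ι) (Finset ι) ℂ) = diagonal fun s => (s.card : ℂ) := by
  ext s t
  simp only [totalNumberOp, numberAt_eq_diagonal, Matrix.sum_apply, diagonal_apply]
  split_ifs with h
  · simp [Finset.univ_inter]
  · simp

/-- `(-1)^N = ∏_i (1 - 2 n_i)` (the factors commute by `numberAt_commute`).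
Tasaki (2020) §9.2. [cite: Tasaki2020] -/
def parityOp_eq_noncommProd : Prop :=
  (parityOp : Matrix (Finset ι) (Finset ι) ℂ) =
      (univ : Finset ι).noncommProd (fun i => 1 - 2 • numberAt i)
        (fun i _ j _ _ => (Commute.one_right _).sub_right
          (((Commute.one_left _).sub_left ((numberAt_commute i j).smul_left 2)).smul_right 2))

/-- `c_i` anticommutes with the parity operator. Tasaki (2020) §9.2. [cite: Tasaki2020] -/
def parityOp_mul_annihilation : Prop :=
  ∀ (i : ι),
    parityOp * annihilation i = -(annihilation i * parityOp)

/-! ### The `N`-particle sector as a submodule -/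

omit [Fintype ι] in
/-- The `N`-particle sector `{ψ | IsNParticle N ψ}` as a `ℂ`-submodule of the Fock space.
Tasaki (2020) §9.2. [cite: Tasaki2020] -/
def nParticleSubmodule (N : ℕ) : Submodule ℂ (Fock ι) where
  carrier := {ψ | IsNParticle N ψ}
  add_mem' {ψ φ} hψ hφ s hs := by simp [Pi.add_apply, hψ s hs, hφ s hs]
  zero_mem' _ _ := rfl
  smul_mem' a ψ hψ s hs := by simp [hψ s hs]

omit [LinearOrder ι] [Fintype ι] in
/-- Membership in the `N`-particle sector is `IsNParticle N`. Tasaki (2020) §9.2. [cite: Tasaki2020] -/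
@[simp] theorem mem_nParticleSubmodule_iff (N : ℕ) (ψ : Fock ι) :
    ψ ∈ nParticleSubmodule N ↔ IsNParticle N ψ := Iff.rfl

/-- The `N`-particle sector is the `N`-eigenspace of the number operator.
Tasaki (2020) §9.2. [cite: Tasaki2020] -/
def nParticleSubmodule_eq_eigenspace : Prop :=
  ∀ (N : ℕ),
    (nParticleSubmodule N : Submodule ℂ (Fock ι)) =
      Module.End.eigenspace (Matrix.toLin' totalNumberOp) (N : ℂ)

/-- `c†_i` maps the `N`-particle sector to the `(N+1)`-particle sector.
Bratteli–Robinson II §5.2.2. [cite: BratteliRobinsonII1997, §5.2.2] -/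
def IsNParticle.creation_mulVec : Prop :=
  ∀ {N : ℕ} {ψ : Fock ι}, IsNParticle N ψ → ∀ i : ι, IsNParticle (N + 1) (creation i *ᵥ ψ)

/-- `c_i` maps the `(N+1)`-particle sector to the `N`-particle sector.
Bratteli–Robinson II §5.2.2. [cite: BratteliRobinsonII1997, §5.2.2] -/
def IsNParticle.annihilation_mulVec : Prop :=
  ∀ {N : ℕ} {ψ : Fock ι}, IsNParticle (N + 1) ψ → ∀ i : ι, IsNParticle N (annihilation i *ᵥ ψ)

/-! ### Bridges to `EuclideanSpace` and `ExteriorAlgebra` -/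

/-- The Fock space as a Euclidean space `ℓ²(Finset ι)` (the identity map, through
`WithLp.linearEquiv`). Bratteli–Robinson II §5.2.1. [folklore] -/
def Fock.toEuclidean : Fock ι ≃ₗ[ℂ] EuclideanSpace ℂ (Finset ι) :=
  (WithLp.linearEquiv 2 ℂ (Finset ι → ℂ)).symm

omit [LinearOrder ι] in
/-- Wave0's `expect A ψ = star ψ ⬝ᵥ (A ψ)` is the inner product `⟪ψ, A ψ⟫` in `ℓ²(Finset ι)`.
Bratteli–Robinson II §5.2.1. [folklore] -/
theorem expect_eq_inner (A : Matrix (Finset ι) (Finset ι) ℂ) (ψ : Fock ι) :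
    expect A ψ = ⟪Fock.toEuclidean ψ, Fock.toEuclidean (A *ᵥ ψ)⟫_ℂ := by
  simp only [QuantumLattice.expect, Fock.toEuclidean, EuclideanSpace.inner_eq_star_dotProduct,
    dotProduct_comm]
  rfl

/-- The Fock space is the exterior algebra `⋀ ℂ^ι`: the linear equivalence sending the
occupation basis vector `|s⟩` (`s = {i₁ < ⋯ < i_k}`) to `e_{i₁} ∧ ⋯ ∧ e_{i_k}`, built from
Mathlib's basis `(Pi.basisFun ℂ ι).ExteriorAlgebra` of the exterior algebra indexed by
`Finset ι`. Bratteli–Robinson II §5.2.1, Example 5.2.2. [folklore] -/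
noncomputable def fockExteriorEquiv : Fock ι ≃ₗ[ℂ] ExteriorAlgebra ℂ (ι → ℂ) :=
  (Pi.basisFun ℂ ι).ExteriorAlgebra.equivFun.symm

omit [Fintype ι] in
/-- `fockExteriorEquiv` sends `|s⟩` to the basis wedge indexed by `s`.
Bratteli–Robinson II §5.2.1. [folklore] -/
theorem fockExteriorEquiv_single [Fintype ι] (s : Finset ι) :
    fockExteriorEquiv (Pi.single s 1 : Fock ι) = (Pi.basisFun ℂ ι).ExteriorAlgebra s := by
  simp [fockExteriorEquiv]

/-- Under `fockExteriorEquiv`, the creation operator `c†_i` is left exterior multiplication by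
`e_i` (this fixes the Jordan–Wigner sign convention of Wave0).
Bratteli–Robinson II §5.2.1, Example 5.2.2. [cite: BratteliRobinsonII1997, §5.2.1 Example 5.2.2] -/
def creation_eq_wedge : Prop :=
  ∀ (i : ι) (ψ : Fock ι),
    fockExteriorEquiv (creation i *ᵥ ψ) =
      ExteriorAlgebra.ι ℂ (Pi.single i 1) * fockExteriorEquiv ψ

/-! ### Particle–hole transformation -/

/-- The particle–hole transformation with phases `ε`: the matrix `U` with
`U |s⟩ = (∏_{i ∈ s} conj (ε i) · (-1)^{#{j | j < i}}) |sᶜ⟩`, characterised (for unimodular `ε`)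
by `U |∅⟩ = c†_{i₁} ⋯ c†_{i_n} |∅⟩` (all orbitals, increasing order) and `U c_i U⋆ = ε_i c†_i`.
Lieb, PRL 62 (1989) 1201; Tasaki (2020) §9.3.3. [cite: Tasaki2020] -/
def particleHole (ε : ι → ℂ) : Matrix (Finset ι) (Finset ι) ℂ :=
  fun t s => if t = sᶜ then ∏ i ∈ s, star (ε i) * jwSign i (univ : Finset ι) else 0

/-- For unimodular phases the particle–hole transformation is unitary.
Tasaki (2020) §9.3.3. [cite: Tasaki2020] -/
def particleHole_mem_unitaryGroup : Prop :=
  ∀ ε : ι → ℂ, (∀ i, ‖ε i‖ = 1) → particleHole ε ∈ Matrix.unitaryGroup (Finset ι) ℂ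

/-- The particle–hole transformation conjugates `c_i` to `ε_i c†_i`.
Tasaki (2020) §9.3.3. [cite: Tasaki2020] -/
def particleHole_mul_annihilation_mul_conjTranspose : Prop :=
  ∀ ε : ι → ℂ, (∀ i, ‖ε i‖ = 1) → ∀ i : ι,
    particleHole ε * annihilation i * (particleHole ε)ᴴ = ε i • creation i

/-- The particle–hole transformation sends `n_i` to `1 - n_i`. Tasaki (2020) §9.3.3. [cite: Tasaki2020] -/
def particleHole_mul_numberAt_mul_conjTranspose : Prop :=
  ∀ ε : ι → ℂ, (∀ i, ‖ε i‖ = 1) → ∀ i : ι,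
    particleHole ε * numberAt i * (particleHole ε)ᴴ = 1 - numberAt i

end Fock

/-! ### Hubbard orbitals: bridges to Wave0, spin and `η`-pairing operators -/

section Hubbard

variable {Λ : Type*} [LinearOrder Λ] [Fintype Λ]

/-- Bridge to Wave0: `numberAt (orb x σ)` is the Hubbard number operator `n_{xσ}`.
Lieb, arXiv:cond-mat/9311033 §2. [cite: arXiv9311033] -/
@[simp] theorem numberAt_orb (x : Λ) (σ : Fin 2) :
    numberAt (orb x σ) = QuantumLattice.numberOp x σ := rfl

/-- Bridge to Wave0: the total number operator on `Orb Λ` is Hubbard's `totalNumber`.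
Lieb, arXiv:cond-mat/9311033 §2. [cite: arXiv9311033] -/
theorem totalNumberOp_eq_totalNumber :
    (totalNumberOp : Matrix (Finset (Orb Λ)) (Finset (Orb Λ)) ℂ) = QuantumLattice.totalNumber := by
  unfold totalNumberOp QuantumLattice.totalNumber
  rw [← Fintype.sum_prod_type', ← (toLex : Λ × Fin 2 ≃ Orb Λ).sum_comp]
  rfl

/-- The spin-lowering operator `S⁻ = (S⁺)ᴴ = Σ_x c†_{x↓} c_{x↑}`. Lieb, PRL 62 (1989) 1201. [folklore] -/
def spinMinus : Matrix (Finset (Orb Λ)) (Finset (Orb Λ)) ℂ := spinPlusᴴ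

/-- `S⁻ = Σ_x c†_{x↓} c_{x↑}`. Lieb, PRL 62 (1989) 1201. [folklore] -/
theorem spinMinus_eq_sum :
    (spinMinus : Matrix (Finset (Orb Λ)) (Finset (Orb Λ)) ℂ) =
      ∑ x : Λ, creation (orb x 1) * annihilation (orb x 0) := by
  simp [spinMinus, spinPlus, conjTranspose_sum, conjTranspose_mul, creation]

/-- The total spin vector `(S^x, S^y, S^z)` of the Hubbard model,
`S^x = (S⁺ + S⁻)/2`, `S^y = (S⁺ - S⁻)/(2i)`, `S^z` = Wave0 `spinZ`.
Lieb, PRL 62 (1989) 1201; Tasaki (2020) §9.3. [cite: Tasaki2020] -/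
noncomputable def spinVecF : Fin 3 → Matrix (Finset (Orb Λ)) (Finset (Orb Λ)) ℂ :=
  ![(1 / 2 : ℂ) • (spinPlus + spinMinus), (-Complex.I / 2) • (spinPlus - spinMinus), spinZ]

/-- The spin components are Hermitian. Tasaki (2020) §9.3. [cite: Tasaki2020] -/
def spinVecF_isHermitian : Prop :=
  ∀ (α : Fin 3),
    (spinVecF α : Matrix (Finset (Orb Λ)) _ ℂ).IsHermitian

/-- `su(2)` relations of the total spin: `[S⁺, S⁻] = 2 S^z`, `[S^z, S⁺] = S⁺`.
Tasaki (2020) §9.3, (9.3.6). [cite: Tasaki2020] -/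
def spin_su2_relations : Prop :=
  (spinPlus * spinMinus - spinMinus * spinPlus : Matrix (Finset (Orb Λ)) _ ℂ) = (2 : ℂ) • spinZ ∧
      (spinZ * spinPlus - spinPlus * spinZ : Matrix (Finset (Orb Λ)) _ ℂ) = spinPlus

/-- Wave0's Casimir `spinSq` is `Σ_α (S^α)²`. Tasaki (2020) §9.3. [cite: Tasaki2020] -/
def spinSq_eq_sum_spinVecF_sq : Prop :=
  (spinSq : Matrix (Finset (Orb Λ)) _ ℂ) = ∑ α : Fin 3, spinVecF α * spinVecF α

/-- Yang's `η`-raising operator with signs `ε : Λ → ℤˣ` (the bipartite stagger `(-1)^x`):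
`η† = Σ_x ε_x c†_{x↑} c†_{x↓}`. Yang, PRL 63 (1989) 2144, eq. (4). [folklore] -/
def etaRaise (ε : Λ → ℤˣ) : Matrix (Finset (Orb Λ)) (Finset (Orb Λ)) ℂ :=
  ∑ x : Λ, ((ε x : ℤ) : ℂ) • (creation (orb x 0) * creation (orb x 1))

/-- Yang's `η`-lowering operator `η = (η†)ᴴ = Σ_x ε_x c_{x↓} c_{x↑}`.
Yang, PRL 63 (1989) 2144, eq. (4). [folklore] -/
def etaLower (ε : Λ → ℤˣ) : Matrix (Finset (Orb Λ)) (Finset (Orb Λ)) ℂ := (etaRaise ε)ᴴ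

/-- `η^z = ½ (N - |Λ|) = ½ Σ_x (n_{x↑} + n_{x↓} - 1)`. Yang, PRL 63 (1989) 2144;
Yang–Zhang, Mod. Phys. Lett. B 4 (1990) 759. [folklore] -/
noncomputable def etaZ : Matrix (Finset (Orb Λ)) (Finset (Orb Λ)) ℂ :=
  (1 / 2 : ℂ) • (QuantumLattice.totalNumber - (Fintype.card Λ : ℂ) • 1)

/-- `η = Σ_x ε_x c_{x↓} c_{x↑}`. Yang, PRL 63 (1989) 2144, eq. (4). [cite: Yang1989, eq. (4)] -/
def etaLower_eq_sum : Prop :=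
  ∀ (ε : Λ → ℤˣ),
    etaLower ε = ∑ x : Λ, ((ε x : ℤ) : ℂ) • (annihilation (orb x 1) * annihilation (orb x 0))

/-- `su(2)` relations of the `η`-pairing operators (for signs `ε_x = ±1`):
`[η†, η] = 2 η^z`, `[η^z, η†] = η†`. Yang, PRL 63 (1989) 2144; Yang–Zhang (1990). [cite: YangZhang1990] -/
def eta_su2_relations : Prop :=
  ∀ (ε : Λ → ℤˣ),
    etaRaise ε * etaLower ε - etaLower ε * etaRaise ε = (2 : ℂ) • etaZ ∧
      etaZ * etaRaise ε - etaRaise ε * etaZ = etaRaise ε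

/-- `η†` raises the particle number by two: `[N, η†] = 2 η†`. Yang, PRL 63 (1989) 2144. [cite: Yang1989] -/
def totalNumber_commutator_etaRaise : Prop :=
  ∀ (ε : Λ → ℤˣ),
    QuantumLattice.totalNumber * etaRaise ε - etaRaise ε * QuantumLattice.totalNumber = (2 : ℂ) • etaRaise ε

/-- The `η` operators commute with the spin operators: `[η†, S⁺] = 0`, `[η†, S^z] = 0`.
Yang–Zhang, Mod. Phys. Lett. B 4 (1990) 759 (`SO(4)` symmetry). [cite: YangZhang1990] -/
def etaRaise_commute_spin : Prop :=
  ∀ (ε : Λ → ℤˣ),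
    Commute (etaRaise ε) (spinPlus : Matrix (Finset (Orb Λ)) _ ℂ) ∧ Commute (etaRaise ε) spinZ

end Hubbard

/-! ### Proof of `creation_eq_wedge`

Left exterior multiplication by a generator on Mathlib's basis `Module.Basis.ExteriorAlgebra`
of `⋀ M` (indexed by `Finset I`, wedges of basis vectors in increasing order): `e_i ∧ e_s = 0`
if `i ∈ s`, and `e_i ∧ e_s = (-1)^{#{j ∈ s | j < i}} e_{insert i s}` otherwise
(`ι_mul_basisExteriorAlgebra`), proved by `Finset.induction_on_min` from
`e_{insert i s} = e_i ∧ e_s` for `i` below `s` (`ExteriorAlgebra.ιMulti_succ_apply`) and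
`e_i ∧ e_a = -e_a ∧ e_i` (`ExteriorAlgebra.ι_add_mul_swap`). Together with the column
computation `c†_i |s⟩ = jwSign i s |insert i s⟩` (`creation_mulVec_single`) and linearity this
gives `creation_eq_wedge_holds`. -/

section ExteriorBasis

variable {R M : Type*} {I : Type*} [LinearOrder I] [CommRing R]
  [AddCommGroup M] [Module R M] (b : Module.Basis I R M)

/-- The basis wedge `e_s` is `ιMulti` of the increasing enumeration `s.orderEmbOfFin` of `s`
(Mathlib's `ExteriorAlgebra.basis_apply` with the cardinality proof abstracted). [folklore] -/
theorem basisExteriorAlgebra_eq_ιMulti {n : ℕ} {s : Finset I} (h : s.card = n) :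
    b.ExteriorAlgebra s = ExteriorAlgebra.ιMulti R n (b ∘ (s.orderEmbOfFin h)) := by
  subst h
  rw [ExteriorAlgebra.basis_apply]
  rfl

/-- Adjoining a new minimum: `e_{insert i s} = e_i ∧ e_s` when `i < j` for all `j ∈ s`
(the increasing enumeration of `insert i s` is `i` followed by that of `s`). [folklore] -/
theorem basisExteriorAlgebra_insert_of_forall_lt (i : I) (s : Finset I) (h : ∀ j ∈ s, i < j) :
    b.ExteriorAlgebra (insert i s) = ExteriorAlgebra.ι R (b i) * b.ExteriorAlgebra s := by
  have hi : i ∉ s := fun hi => lt_irrefl _ (h i hi)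
  have hcard : (insert i s).card = s.card + 1 := Finset.card_insert_of_notMem hi
  have key : (Fin.cons i (s.orderEmbOfFin rfl) : Fin (s.card + 1) → I) =
      (insert i s).orderEmbOfFin hcard := by
    refine Finset.orderEmbOfFin_unique hcard (fun x => ?_) (fun x y hxy => ?_)
    · induction x using Fin.cases with
      | zero => simp
      | succ j => simp
    · induction x using Fin.cases with
      | zero =>
        induction y using Fin.cases with
        | zero => exact absurd hxy (lt_irrefl _)
        | succ y => simpa using h _ (Finset.orderEmbOfFin_mem _ _ y)
      | succ x =>
        induction y using Fin.cases with
        | zero => exact absurd hxy (Fin.not_lt_zero _)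
        | succ y => simpa using (s.orderEmbOfFin rfl).strictMono (Fin.succ_lt_succ_iff.mp hxy)
  rw [basisExteriorAlgebra_eq_ιMulti b hcard, basisExteriorAlgebra_eq_ιMulti b (rfl : s.card = _),
    ← key, ExteriorAlgebra.ιMulti_succ_apply]
  congr 1

/-- Left multiplication by a generator on the basis wedges: `e_i ∧ e_s = 0` if `i ∈ s`, and
`e_i ∧ e_s = (-1)^{#{j ∈ s | j < i}} e_{insert i s}` otherwise (move `e_i` past the
`#{j ∈ s | j < i}` smaller basis vectors). Bratteli–Robinson II §5.2.1;
Evans–Kawahigashi (1998) §4.8, p. 197. [folklore] -/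
theorem ι_mul_basisExteriorAlgebra (i : I) (s : Finset I) :
    ExteriorAlgebra.ι R (b i) * b.ExteriorAlgebra s =
      if i ∈ s then 0
      else ((-1 : R) ^ (s.filter (· < i)).card) • b.ExteriorAlgebra (insert i s) := by
  induction s using Finset.induction_on_min with
  | empty =>
    rw [basisExteriorAlgebra_insert_of_forall_lt b i ∅ (by simp)]
    simp
  | insert a s ha ih =>
    rw [basisExteriorAlgebra_insert_of_forall_lt b a s ha]
    rcases lt_trichotomy i a with hlt | rfl | hgt
    · have h' : ∀ x ∈ insert a s, i < x :=
        (Finset.forall_mem_insert _ _ _).mpr ⟨hlt, fun x hx => hlt.trans (ha x hx)⟩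
      have hnot : i ∉ insert a s := fun hmem => lt_irrefl _ (h' i hmem)
      have hfil : (insert a s).filter (· < i) = ∅ :=
        Finset.filter_eq_empty_iff.mpr fun x hx hxi => lt_asymm hxi (h' x hx)
      rw [← basisExteriorAlgebra_insert_of_forall_lt b a s ha,
        ← basisExteriorAlgebra_insert_of_forall_lt b i _ h', if_neg hnot, hfil]
      simp
    · rw [← mul_assoc, ExteriorAlgebra.ι_sq_zero, zero_mul, if_pos (Finset.mem_insert_self _ _)]
    · have hia : i ≠ a := ne_of_gt hgt
      rw [← mul_assoc, eq_neg_of_add_eq_zero_left (ExteriorAlgebra.ι_add_mul_swap (b i) (b a)),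
        neg_mul, mul_assoc, ih]
      by_cases his : i ∈ s
      · simp [his]
      · have hnot : i ∉ insert a s := by simp [hia, his]
        have h' : ∀ x ∈ insert i s, a < x := (Finset.forall_mem_insert _ _ _).mpr ⟨hgt, ha⟩
        have hafil : a ∉ s.filter (· < i) := fun hmem =>
          lt_irrefl a (ha a (Finset.mem_filter.mp hmem).1)
        rw [if_neg his, if_neg hnot, mul_smul_comm,
          ← basisExteriorAlgebra_insert_of_forall_lt b a (insert i s) h', Finset.insert_comm,
          Finset.filter_insert, if_pos hgt, Finset.card_insert_of_notMem hafil, pow_succ,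
          mul_neg_one, neg_smul]

end ExteriorBasis

section FockWedge

variable {ι : Type*} [LinearOrder ι] [Fintype ι]

/-- The column `s` of the Jordan–Wigner matrix `c†_i`: `c†_i |s⟩ = 0` if `i ∈ s`, and
`c†_i |s⟩ = jwSign i s |insert i s⟩ = (-1)^{#{j ∈ s | j < i}} |insert i s⟩` otherwise.
Tasaki (2020) §9.2; Bratteli–Robinson II §5.2.1. [folklore] -/
theorem FermionOperators.creation_mulVec_single (i : ι) (s : Finset ι) :
    creation i *ᵥ (Pi.single s 1 : Fock ι) =
      if i ∈ s then 0 else jwSign i s • (Pi.single (insert i s) 1 : Fock ι) := by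
  ext t
  rw [Matrix.mulVec_single_one]
  simp only [Matrix.col_apply, creation, conjTranspose_apply, annihilation]
  by_cases hi : i ∈ s
  · simp [hi]
  · by_cases ht : t = insert i s
    · subst ht
      simp [hi, jwSign]
    · simp [hi, ht]

/-- Discharge of `creation_eq_wedge`: under `fockExteriorEquiv` the creation operator `c†_i` is
left exterior multiplication by `e_i`; on basis vectors this is the printed formula
`c*(f) (h₁ ∧ ⋯ ∧ hₙ) = f ∧ h₁ ∧ ⋯ ∧ hₙ` for the creation operator on antisymmetric Fock space,
with `f = e_i` and `h₁ ∧ ⋯ ∧ hₙ = e_s` (the sign `(-1)^{#{j ∈ s | j < i}}` of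
`ι_mul_basisExteriorAlgebra` is exactly Wave0's Jordan–Wigner sign `jwSign i s`).
Bratteli–Robinson II §5.2.1 (Fock space, `a*(f)` on the antisymmetric Fock space `𝔉₋(𝔥)`);
Evans–Kawahigashi (1998), Ch. 4 Notes §4.8, display after (4.8.4).
[cite: BratteliRobinsonII1997, §5.2.1]
[cite: EvansKawahigashi1998, §4.8, display after eq. (4.8.4) (p. 197, PDF page)] -/
theorem creation_eq_wedge_holds : creation_eq_wedge (ι := ι) := by
  intro i ψ
  have key : ∀ s : Finset ι, fockExteriorEquiv (creation i *ᵥ (Pi.single s 1 : Fock ι)) =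
      ExteriorAlgebra.ι ℂ (Pi.single i 1) * fockExteriorEquiv (Pi.single s 1 : Fock ι) := by
    intro s
    have h := ι_mul_basisExteriorAlgebra (Pi.basisFun ℂ ι) i s
    rw [Pi.basisFun_apply] at h
    rw [FermionOperators.creation_mulVec_single, fockExteriorEquiv_single, h]
    split_ifs
    · simp
    · rw [map_smul, fockExteriorEquiv_single]
      rfl
  have hψ : ψ = ∑ s, ψ s • (Pi.single s 1 : Fock ι) := by
    ext t
    simp [Finset.sum_apply, Pi.single_apply]
  rw [hψ]
  simp only [Matrix.mulVec_sum, Matrix.mulVec_smul, map_sum, map_smul, Finset.mul_sum,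
    mul_smul_comm, key]

end FockWedge

end Literature.MathematicalPhysics.QuantumLattice
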